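import Summits.PneNP.PneNP.Theorems.PhaseTwinsMacroscopicTwinsAboveHighActivityIndep
import Summits.PneNP.PneNP.Theorems.PhaseTwinsMacroscopicTwinsAboveHighActivityGauge
import Summits.PneNP.PneNP.Theorems.PhaseTwinsMacroscopicTwinsAboveFarSystems
import Summits.PneNP.PneNP.Theorems.PhaseTwinsPolyDepthTwinsAbove
import Literature.ModelTheory.FiniteModelTheory.CkEquivHomCount

/-!
# Route PhaseTwins, item `MacroscopicTwinsAbove` (stmt-PneNP-2720): density-scale twins at large activity
# (UNCONDITIONAL) and the reduction of the item to a bounded activity window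

`macroscopicTwins_highActivity`: there is an absolute constant `Λ` such that for every `Δ ≥ 3` and `λ ≥ Λ` and
every `k` there are graphs `G, H` on the same `n ≥ 1` vertices, both of maximum degree `≤ 3 ≤ Δ`, homomorphism-
indistinguishable over all graphs of treewidth `< k`, with `e^{n} · Z_H(λ) ≤ Z_G(λ)` — the "known in substance for
large `λ`" half of the item `MacroscopicTwinsAbove` (Atserias–Dawar 2019 §5 + `λ^α ≤ Z ≤ 2^n λ^α`), with the degree
reduced to three. The twins are the conflict-gadget graphs of the far, locally consistent, bounded-occurrence 3-XOR
systems of `stub_farSystems` (constants `D`, `η`; `Λ = exp(8(12D+5)/η)`): Duplicator by `cg_ckEquiv` and the Dvořák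
bridge, degrees by `cg_maxDegree_le`, the gap by `card_planted` / `card_le_of_isIndepSet` and the sandwich
`pow_card_le_independencePolynomial` / `independencePolynomial_le_pow` with the budget `exp_mul_two_pow_le`.
`MacroscopicTwinsAbove_of_window`: consequently the item follows from its restriction to the window
`λ_c(Δ) < λ < Λ` (where phase gadgets are needed: the conditional `PhaseTwinsMacroscopicTwinsAbove`). [folklore]
-/

noncomputable section

open scoped Classical BigOperators

namespace Summit.PneNP.PneNP.Theorems.MacroscopicTwinsAbove.HighActivity

open Finset
open Summit.PneNP.PneNP.Cruxes.MacroscopicTwinsAbove.LiteralGadgetsCfiApparatus (lgScope)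

-- `Summit.PneNP.PneNP.…` (summit = sub-problem name) trips the duplicate-namespace linter on every declaration.
set_option linter.dupNamespace false

variable {nv m D : ℕ}

/-! ## Partition functions and the assembly -/

section Assembly

open Literature.Probability.LatticeModels (independencePolynomial)
open Literature.ModelTheory.FiniteModelTheory (CkEquiv)
open Literature.Combinatorics.SimpleGraph (treewidth)
open Summit.PneNP.PneNP.Cruxes.MacroscopicTwinsAbove.LiteralGadgetsCfiApparatus (stub_farSystems)
open Summit.PneNP.PneNP.Cruxes.PolyDepthTwinsAbove.ParityWiredPorts (independencePolynomial_map_equiv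
  maxDegree_le_of_iso indepSum_eq)
open Summit.PneNP.PneNP.Theses.PhaseTwins (MacroscopicTwinsAbove)

/-- **`Z_G(λ) ≥ λ^{|J|}`** for an independent set `J` (`λ ≥ 0`): one term of the sum. [folklore] -/
theorem pow_card_le_independencePolynomial {V : Type*} [Fintype V] [DecidableEq V] (G : SimpleGraph V)
    {lam : ℝ} (hlam : 0 ≤ lam) {J : Finset V} (hJ : G.IsIndepSet ↑J) :
    lam ^ J.card ≤ independencePolynomial G lam := by
  unfold independencePolynomial
  have h := Finset.single_le_sum (f := fun I : Finset V => if G.IsIndepSet (I : Set V) then lam ^ I.card else 0)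
    (fun I _ => by positivity) (Finset.mem_univ J)
  simpa [hJ] using h

/-- **`Z_G(λ) ≤ 2^{|V|} λ^{A}`** if `λ ≥ 1` and every independent set has at most `A` vertices. [folklore] -/
theorem independencePolynomial_le_pow {V : Type*} [Fintype V] [DecidableEq V] (G : SimpleGraph V)
    {lam : ℝ} (hlam : 1 ≤ lam) {A : ℕ} (hA : ∀ J : Finset V, G.IsIndepSet ↑J → J.card ≤ A) :
    independencePolynomial G lam ≤ 2 ^ Fintype.card V * lam ^ A := by
  unfold independencePolynomial
  calc (∑ I : Finset V, if G.IsIndepSet (I : Set V) then lam ^ I.card else 0)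
      ≤ ∑ _I : Finset V, lam ^ A := by
        refine Finset.sum_le_sum fun I _ => ?_
        split_ifs with hI
        · exact pow_le_pow_right₀ hlam (hA I hI)
        · positivity
    _ = 2 ^ Fintype.card V * lam ^ A := by
        rw [Finset.sum_const, Finset.card_univ, Fintype.card_finset, nsmul_eq_mul]
        push_cast
        ring

/-- **The activity budget**: with `N = 4m(12D+5)` vertices, `t ≥ η m` and `log λ ≥ 8(12D+5)/η`,
`e^{N} · 2^{N} ≤ λ^{t}`. [folklore] -/
theorem exp_mul_two_pow_le {m D t N : ℕ} {η lam : ℝ} (hη : 0 < η) (hlam : 0 < lam)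
    (hlog : 8 * (12 * D + 5) / η ≤ Real.log lam) (htη : η * m ≤ t) (hN : N = 4 * m * (12 * D + 5)) :
    Real.exp N * 2 ^ N ≤ lam ^ t := by
  have hlog0 : 0 ≤ Real.log lam := le_trans (by positivity) hlog
  have h2 : (2 : ℝ) ^ N = Real.exp (N * Real.log 2) := by
    rw [← Real.log_pow, Real.exp_log (by positivity)]
  have hl : lam ^ t = Real.exp (t * Real.log lam) := by
    rw [← Real.log_pow, Real.exp_log (by positivity)]
  rw [h2, hl, ← Real.exp_add, Real.exp_le_exp]
  have hlog2 : Real.log 2 ≤ 1 := by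
    have := Real.log_le_sub_one_of_pos (x := 2) (by norm_num); linarith
  have hN' : (N : ℝ) = 4 * m * (12 * D + 5) := by rw [hN]; push_cast; ring
  have hm0 : (0 : ℝ) ≤ m := Nat.cast_nonneg m
  -- `t log λ ≥ η m · 8(12D+5)/η = 2N`
  have hkey : η * m * (8 * (12 * D + 5) / η) = 2 * (4 * m * (12 * D + 5)) := by
    field_simp
    ring
  have h1 : η * m * (8 * (12 * D + 5) / η) ≤ t * Real.log lam :=
    calc η * m * (8 * (12 * D + 5) / η) ≤ η * m * Real.log lam :=
          mul_le_mul_of_nonneg_left hlog (mul_nonneg hη.le hm0)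
      _ ≤ t * Real.log lam := mul_le_mul_of_nonneg_right htη hlog0
  have hNN : (N : ℝ) * Real.log 2 ≤ N := by
    have hN0 : (0 : ℝ) ≤ N := Nat.cast_nonneg N
    nlinarith
  rw [hkey, ← hN'] at h1
  linarith

/-- **Density-scale twins of maximum degree three at large activity** (UNCONDITIONAL): there is an absolute
constant `Λ` such that for every `Δ ≥ 3` and `λ ≥ Λ` there is `δ > 0` (in fact `δ = 1`) such that for every `k`
there are graphs `G, H` on the same `n ≥ 1` vertices, both of maximum degree `≤ 3 ≤ Δ`, homomorphism-
indistinguishable over all graphs of treewidth `< k`, with `e^{δ n} · Z_H(λ) ≤ Z_G(λ)`. The twins are the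
conflict-gadget graphs `cgGraph E loc 0`, `cgGraph E loc b` of a far, locally consistent, bounded-occurrence 3-XOR
system (`stub_farSystems`): Duplicator by `cg_ckEquiv` and the Dvořák bridge, degrees by `cg_maxDegree_le`, and the
gap because the satisfiable twin has an independent set of `4m(6D+2) + m` vertices (`card_planted`) while every
independent set of the far twin has at most `4m(6D+2) + m - t` (`card_le_of_isIndepSet`), `t ≥ η m`, so
`Z_G ≥ λ^{4m(6D+2)+m} ≥ e^{n} 2^{n} λ^{4m(6D+2)+m-t} ≥ e^{n} Z_H` once `log λ ≥ 8(12D+5)/η` (`n = 4m(12D+5)`). This is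
the "known in substance for large λ" half of `MacroscopicTwinsAbove` (Atserias–Dawar 2019 §5: independent-set
density gaps between `C^k`-twins, plus `λ^α ≤ Z ≤ 2^n λ^α`), with the degree reduced to `3`. [folklore] -/
theorem macroscopicTwins_highActivity :
    ∃ Λ : ℝ, ∀ Δ : ℕ, 3 ≤ Δ → ∀ lam : ℝ, Λ ≤ lam → ∃ δ : ℝ, 0 < δ ∧ ∀ k : ℕ,
      ∃ (n : ℕ) (G H : SimpleGraph (Fin n)), 0 < n ∧ G.maxDegree ≤ Δ ∧ H.maxDegree ≤ Δ ∧
        (∀ (m : ℕ) (F : SimpleGraph (Fin m)), treewidth F < k → Nat.card (F →g G) = Nat.card (F →g H)) ∧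
        Real.exp (δ * n) * (∑ I : Finset (Fin n), (if H.IsIndepSet (↑I : Set (Fin n)) then lam ^ I.card else 0)) ≤
          ∑ I : Finset (Fin n), (if G.IsIndepSet (↑I : Set (Fin n)) then lam ^ I.card else 0) := by
  obtain ⟨D, c, η, hη, hsys⟩ := stub_farSystems
  refine ⟨Real.exp (8 * (12 * D + 5) / η), fun Δ hΔ lam hlam => ⟨1, one_pos, fun k => ?_⟩⟩
  have hlam0 : 0 < lam := (Real.exp_pos _).trans_le hlam
  have hlam1 : 1 ≤ lam := le_trans (Real.one_le_exp (by positivity)) hlam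
  have hlog : 8 * (12 * D + 5) / η ≤ Real.log lam := (Real.le_log_iff_exp_le hlam0).2 hlam
  -- the base system at radius `12 (k + 1)`
  obtain ⟨nv, m, t, E, loc, b, hnv, hnvm, -, hE, hloc, hexp, htη, hfar⟩ := hsys (12 * (k + 1))
  let X : SimpleGraph (CGVert m D) := cgGraph E loc 0
  let X' : SimpleGraph (CGVert m D) := cgGraph E loc b
  let N : ℕ := Fintype.card (CGVert m D)
  have hNcard : N = 4 * m * (12 * D + 5) := card_CGVert m D
  let e : CGVert m D ≃ Fin N := Fintype.equivFin (CGVert m D)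
  -- `t ≤ m`
  have htm : t ≤ m := by
    have h := hfar 0
    exact h.trans ((Finset.card_le_univ _).trans (by simp))
  -- the two independence-number bounds and the partition functions
  have hup : ∀ J : Finset (CGVert m D), X'.IsIndepSet ↑J → J.card ≤ 4 * m * (6 * D + 2) + (m - t) :=
    fun J hJ => card_le_of_isIndepSet hJ hfar
  have hZ' : independencePolynomial X' lam ≤ 2 ^ N * lam ^ (4 * m * (6 * D + 2) + (m - t)) :=
    independencePolynomial_le_pow X' hlam1 hup
  have hZ : lam ^ (4 * m * (6 * D + 2) + m) ≤ independencePolynomial X lam := by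
    rw [← card_planted m D]
    exact pow_card_le_independencePolynomial X hlam0.le (isIndepSet_planted E loc)
  have hbudget : Real.exp N * 2 ^ N ≤ lam ^ t := exp_mul_two_pow_le hη hlam0 hlog htη hNcard
  have htwins : Real.exp (1 * N) * independencePolynomial X' lam ≤ independencePolynomial X lam := by
    rw [one_mul]
    have hsplit : lam ^ (4 * m * (6 * D + 2) + m) = lam ^ t * lam ^ (4 * m * (6 * D + 2) + (m - t)) := by
      rw [← pow_add]; congr 1; omega
    calc Real.exp N * independencePolynomial X' lam
        ≤ Real.exp N * (2 ^ N * lam ^ (4 * m * (6 * D + 2) + (m - t))) :=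
          mul_le_mul_of_nonneg_left hZ' (Real.exp_pos _).le
      _ = (Real.exp N * 2 ^ N) * lam ^ (4 * m * (6 * D + 2) + (m - t)) := by ring
      _ ≤ lam ^ t * lam ^ (4 * m * (6 * D + 2) + (m - t)) :=
          mul_le_mul_of_nonneg_right hbudget (by positivity)
      _ = lam ^ (4 * m * (6 * D + 2) + m) := hsplit.symm
      _ ≤ independencePolynomial X lam := hZ
  -- Duplicator at depth `k + 1`
  have hck : CkEquiv (k + 1) X X' :=
    cg_ckEquiv E hE loc b (s := 12 * (k + 1)) (p := 2) (q := 1) (K₀ := 3 * (k + 1)) (by omega) one_pos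
      (fun T hT => by rw [one_mul]; exact hexp T hT) (by omega) le_rfl
  have hdegX : X.maxDegree ≤ Δ := (cg_maxDegree_le E loc 0 hloc).trans hΔ
  have hdegX' : X'.maxDegree ≤ Δ := (cg_maxDegree_le E loc b hloc).trans hΔ
  refine ⟨N, X.map e.toEmbedding, X'.map e.toEmbedding, ?_, ?_, ?_, ?_, ?_⟩
  · -- `0 < N`
    rw [hNcard]
    have h1 : 1 ≤ m := hnv.trans_le hnvm
    have h2 : 4 * 1 * 5 ≤ 4 * m * (12 * D + 5) := Nat.mul_le_mul (Nat.mul_le_mul_left 4 h1) (by omega)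
    omega
  · exact maxDegree_le_of_iso (SimpleGraph.Iso.map e X) hdegX
  · exact maxDegree_le_of_iso (SimpleGraph.Iso.map e X') hdegX'
  · -- homomorphism indistinguishability below treewidth `k < k + 1`
    intro mF F hF
    have hck' : CkEquiv (k + 1) (X.map e.toEmbedding) (X'.map e.toEmbedding) :=
      hck.iso_congr (SimpleGraph.Iso.map e X) (SimpleGraph.Iso.map e X')
    exact Literature.ModelTheory.FiniteModelTheory.Dvorak2010.homCount_eq_of_ckEquiv (by omega) hck' F
      (Nat.lt_succ_of_lt hF)
  · -- the gap, transported to `Fin N`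
    have hZZ := htwins
    rw [← independencePolynomial_map_equiv X e lam, ← independencePolynomial_map_equiv X' e lam] at hZZ
    convert hZZ using 2 <;> exact indepSum_eq _ _

/-- **The item reduces to a bounded activity window** (what remains of `MacroscopicTwinsAbove` after
`macroscopicTwins_highActivity`): for the absolute constant `Λ` of that theorem, density-scale twins in the window
`λ_c(Δ) < λ < Λ` for every `Δ ≥ 3` already give `MacroscopicTwinsAbove`. [folklore] -/
theorem MacroscopicTwinsAbove_of_window :
    ∃ Λ : ℝ, (∀ Δ : ℕ, 3 ≤ Δ → ∀ lam : ℝ, ((Δ : ℝ) - 1) ^ (Δ - 1) / ((Δ : ℝ) - 2) ^ Δ < lam → lam < Λ →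
      ∃ δ : ℝ, 0 < δ ∧ ∀ k : ℕ, ∃ (n : ℕ) (G H : SimpleGraph (Fin n)), 0 < n ∧ G.maxDegree ≤ Δ ∧ H.maxDegree ≤ Δ ∧
        (∀ (m : ℕ) (F : SimpleGraph (Fin m)), treewidth F < k → Nat.card (F →g G) = Nat.card (F →g H)) ∧
        Real.exp (δ * n) * (∑ I : Finset (Fin n), (if H.IsIndepSet (↑I : Set (Fin n)) then lam ^ I.card else 0)) ≤
          ∑ I : Finset (Fin n), (if G.IsIndepSet (↑I : Set (Fin n)) then lam ^ I.card else 0)) →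
      MacroscopicTwinsAbove := by
  obtain ⟨Λ, hΛ⟩ := macroscopicTwins_highActivity
  refine ⟨Λ, fun hwin Δ hΔ lam hlam => ?_⟩
  rcases lt_or_ge lam Λ with h | h
  · exact hwin Δ hΔ lam hlam h
  · exact hΛ Δ hΔ lam h

/-- Independence is transported along a bijection of the vertices. [folklore] -/
theorem isIndepSet_map_equiv_iff {α β : Type*} (G : SimpleGraph α) (e : α ≃ β) (I : Finset α) :
    (G.map e.toEmbedding).IsIndepSet (↑(I.map e.toEmbedding) : Set β) ↔ G.IsIndepSet (↑I : Set α) := by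
  have hadj : ∀ a b : α, (G.map e.toEmbedding).Adj (e.toEmbedding a) (e.toEmbedding b) ↔ G.Adj a b :=
    fun a b => SimpleGraph.map_adj_apply
  constructor
  · intro h a ha b hb hab
    have hab' : e.toEmbedding a ≠ e.toEmbedding b := fun h' => hab (e.injective h')
    have := h (Finset.mem_coe.2 (Finset.mem_map_of_mem _ (Finset.mem_coe.1 ha)))
      (Finset.mem_coe.2 (Finset.mem_map_of_mem _ (Finset.mem_coe.1 hb))) hab'
    exact fun hG => this ((hadj a b).2 hG)
  · intro h x hx y hy hxy
    obtain ⟨a, ha, rfl⟩ := Finset.mem_map.1 (Finset.mem_coe.1 hx)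
    obtain ⟨b, hb, rfl⟩ := Finset.mem_map.1 (Finset.mem_coe.1 hy)
    exact fun hG => h (Finset.mem_coe.2 ha) (Finset.mem_coe.2 hb) (fun hab => hxy (by rw [hab]))
      ((hadj a b).1 hG)

/-- The independence number does not drop along a bijection of the vertices. [folklore] -/
theorem le_indepNum_map_equiv {α β : Type*} [Fintype α] [Fintype β] (G : SimpleGraph α) (e : α ≃ β)
    {J : Finset α} (hJ : G.IsIndepSet ↑J) : J.card ≤ (G.map e.toEmbedding).indepNum := by
  rw [← Finset.card_map e.toEmbedding]
  exact ((isIndepSet_map_equiv_iff G e J).2 hJ).card_le_indepNum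

/-- The independence number along a bijection is bounded by any bound on the independent sets. [folklore] -/
theorem indepNum_map_equiv_le {α β : Type*} [Fintype α] [Fintype β] (G : SimpleGraph α) (e : α ≃ β)
    {A : ℕ} (hA : ∀ J : Finset α, G.IsIndepSet ↑J → J.card ≤ A) : (G.map e.toEmbedding).indepNum ≤ A := by
  obtain ⟨s, hs⟩ := (G.map e.toEmbedding).exists_isNIndepSet_indepNum
  have hind : G.IsIndepSet ↑(s.map e.symm.toEmbedding) := by
    rw [← isIndepSet_map_equiv_iff G e]
    have : (s.map e.symm.toEmbedding).map e.toEmbedding = s := by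
      rw [Finset.map_map]; convert Finset.map_refl (s := s); ext x; simp
    rw [this]; exact hs.1
  have h := hA _ hind
  rw [Finset.card_map, hs.2] at h
  exact h

/-- **Independence-number gap twins of maximum degree three** (UNCONDITIONAL, the combinatorial core of
`macroscopicTwins_highActivity`): for some `η' > 0` and every `k` there are graphs `G, H` on the same `n ≥ 1`
vertices, both of maximum degree `≤ 3`, homomorphism-indistinguishable over all graphs of treewidth `< k`, whose
independence numbers differ by at least `η' n`: `α(H) + η' n ≤ α(G)`. (Atserias–Dawar 2019 §5 give such twins of SOME
bounded degree via vertex-cover interpretations of 3-XOR; here the degree is three.) [folklore] -/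
theorem indepGapTwins_degreeThree :
    ∃ η' : ℝ, 0 < η' ∧ ∀ k : ℕ, ∃ (n : ℕ) (G H : SimpleGraph (Fin n)), 0 < n ∧ G.maxDegree ≤ 3 ∧ H.maxDegree ≤ 3 ∧
      (∀ (m : ℕ) (F : SimpleGraph (Fin m)), treewidth F < k → Nat.card (F →g G) = Nat.card (F →g H)) ∧
      (H.indepNum : ℝ) + η' * n ≤ G.indepNum := by
  obtain ⟨D, c, η, hη, hsys⟩ := stub_farSystems
  refine ⟨η / (4 * (12 * D + 5)), by positivity, fun k => ?_⟩
  obtain ⟨nv, m, t, E, loc, b, hnv, hnvm, -, hE, hloc, hexp, htη, hfar⟩ := hsys (12 * (k + 1))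
  let X : SimpleGraph (CGVert m D) := cgGraph E loc 0
  let X' : SimpleGraph (CGVert m D) := cgGraph E loc b
  let N : ℕ := Fintype.card (CGVert m D)
  have hNcard : N = 4 * m * (12 * D + 5) := card_CGVert m D
  let e : CGVert m D ≃ Fin N := Fintype.equivFin (CGVert m D)
  have htm : t ≤ m := (hfar 0).trans ((Finset.card_le_univ _).trans (by simp))
  have hlo : 4 * m * (6 * D + 2) + m ≤ (X.map e.toEmbedding).indepNum := by
    rw [← card_planted m D]
    exact le_indepNum_map_equiv X e (isIndepSet_planted E loc)
  have hhi : (X'.map e.toEmbedding).indepNum ≤ 4 * m * (6 * D + 2) + (m - t) :=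
    indepNum_map_equiv_le X' e fun J hJ => card_le_of_isIndepSet hJ hfar
  have hck : CkEquiv (k + 1) X X' :=
    cg_ckEquiv E hE loc b (s := 12 * (k + 1)) (p := 2) (q := 1) (K₀ := 3 * (k + 1)) (by omega) one_pos
      (fun T hT => by rw [one_mul]; exact hexp T hT) (by omega) le_rfl
  refine ⟨N, X.map e.toEmbedding, X'.map e.toEmbedding, ?_, ?_, ?_, ?_, ?_⟩
  · rw [hNcard]
    have h1 : 1 ≤ m := hnv.trans_le hnvm
    have h2 : 4 * 1 * 5 ≤ 4 * m * (12 * D + 5) := Nat.mul_le_mul (Nat.mul_le_mul_left 4 h1) (by omega)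
    omega
  · exact maxDegree_le_of_iso (SimpleGraph.Iso.map e X) (cg_maxDegree_le E loc 0 hloc)
  · exact maxDegree_le_of_iso (SimpleGraph.Iso.map e X') (cg_maxDegree_le E loc b hloc)
  · intro mF F hF
    have hck' : CkEquiv (k + 1) (X.map e.toEmbedding) (X'.map e.toEmbedding) :=
      hck.iso_congr (SimpleGraph.Iso.map e X) (SimpleGraph.Iso.map e X')
    exact Literature.ModelTheory.FiniteModelTheory.Dvorak2010.homCount_eq_of_ckEquiv (by omega) hck' F
      (Nat.lt_succ_of_lt hF)
  · -- the gap `t ≥ η m = η' N`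
    have hlo' : ((4 * m * (6 * D + 2) + m : ℕ) : ℝ) ≤ (X.map e.toEmbedding).indepNum := by exact_mod_cast hlo
    have hhi' : ((X'.map e.toEmbedding).indepNum : ℝ) ≤ ((4 * m * (6 * D + 2) + (m - t) : ℕ) : ℝ) := by
      exact_mod_cast hhi
    have hN' : (N : ℝ) = 4 * m * (12 * D + 5) := by rw [hNcard]; push_cast; ring
    have hgap : η / (4 * (12 * D + 5)) * N ≤ t := by
      rw [hN']
      have : η / (4 * (12 * D + 5)) * (4 * m * (12 * D + 5)) = η * m := by
        field_simp
      rw [this]; exact htη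
    have hsub : ((4 * m * (6 * D + 2) + (m - t) : ℕ) : ℝ) + t = ((4 * m * (6 * D + 2) + m : ℕ) : ℝ) := by
      have : 4 * m * (6 * D + 2) + (m - t) + t = 4 * m * (6 * D + 2) + m := by omega
      exact_mod_cast this
    linarith

end Assembly

end Summit.PneNP.PneNP.Theorems.MacroscopicTwinsAbove.HighActivity
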